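import Summits.QuantumFields.YangMills.Theorems.IR.HaarCodingFormat

/-!
# Line `haar-coding` (crux `IR`, stmt-QuantumFields-19354): the ENGINE «Haar-coded ⇒ clustering» (E_cod) — PROVED

Route `BalabanLadder`, crux `IR`, line `haar-coding` (ideator ym-ir-idea-4, skeleton `Cruxes/IR/Lines/haar_coding.lean`,
stub `stub_codedClustering` = E_cod, «ENGINE, M, provable now, group-blind»), pooled prover `ym-ir-line-bsf-p1`
(director-ym R366: «bsf-p1 lands beta-slope non-XL stubs THEN haar-coding E_cod»).

`codedClustering` — for every compact `G`, lattice representation `r`, tail constant `K` and species `A, B` there is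
`C = C(A, B, K)` such that: if the torus Wilson measure at `β` is HAAR-CODED at radius `b ≥ 1` with tail constant `K`
(`HaarCoded`: push-forward of the product Haar noise under a measurable map `Φ` every output link of which agrees, off
a noise event of mass `≤ K e^{-k}`, with a function of the noise inside the input ball of radius `k b`, all `k ≥ 1`),
then on every torus `(2S+1)⁴ ⊇ 4b` and for all `t ≤ S`,
`|⟨A · τ_t B⟩ − ⟨A⟩⟨B⟩| ≤ C e^{−t/(4b)}`.  This is the skeleton's `FmtClustering r (HaarCoded r.ρ K) (1/4) 4` with
`FmtClustering`, `HaarCoded`, `haarNoise`, `inputBall`, `supDist` δ-unfolded / restated with identical bodies in the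
namespace `HaarCodingEngine` (so the skeleton's `stub_codedClustering` closes by `fun G _ _ _ _ _ _ r K A B =>
HaarCodingEngine.codedClustering r K A B`, definitional unfolding only).

Proof (§3): push the three Wilson integrals forward to the noise (`integral_map`); replace each output link read by `A`
(resp. `τ_t B`) by its local code `Ψ_{e,k}` with `k = ⌊(t − 2D − 1)/(2b)⌋` (`D` = time extent of the two supports),
paying `2‖A‖‖B‖ · (#supp) · K⁺ e^{-k}` per observable (`abs_integral_sub_le_of_eq_off`); the replaced observables depend
on DISJOINT sets of noise links (§1: input balls of radius `kb` about time `0` and time `t` do not meet on the torus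
when `2(kb + D) < t ≤ S`), hence are uncorrelated (`integral_mul_eq_of_dependsOn_disjoint`); finally
`e^{-k} ≤ e^{1 + (2D+1)/2} e^{−t/(4b)}` and the small-`t` regime is absorbed in the constant.

Honest framing: a group-blind engine; it says nothing about WHETHER Wilson measures are Haar-coded at weak coupling
(the line's XL stub `stub_codedOnset`), and nothing here bears on the Yang–Mills mass gap (Clay).  R4 of the ladder
closes only the conditional finite-𝕋⁴ rung `BalabanLadder.UV`.
Refs: Y. Spinka, Ann. Probab. 48 (2020) 2088–2117 (arXiv:1803.10578), Thm 1.1; J. van den Berg, J. Steif,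
Ann. Probab. 27 (1999); line card `Cruxes/IR/Lines/haar_coding.md`.
-/

set_option autoImplicit false

noncomputable section

open MeasureTheory Function Classical
open Literature.MathematicalPhysics.QuantumFieldTheory Literature.MathematicalPhysics.QuantumLattice

namespace Summit.QuantumFields.YangMills.Cruxes.IR.HaarCodingEngine

/-! ## §3 The engine -/

section Engine

variable {G : Type} [Group G] [TopologicalSpace G] [IsTopologicalGroup G] [CompactSpace G]
  [MeasurableSpace G] [BorelSpace G]

/-- Integrals of observables bounded by `C` on a probability space are bounded by `C`. -/
theorem abs_integral_le_of_abs_le {Ω : Type*} [MeasurableSpace Ω] (ν : Measure Ω) [IsProbabilityMeasure ν]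
    {f : Ω → ℝ} {C : ℝ} (hf : ∀ ω, |f ω| ≤ C) : |∫ ω, f ω ∂ν| ≤ C := by
  have h := norm_integral_le_of_norm_le_const (μ := ν) (f := f) (C := C)
    (ae_of_all _ fun ω => by rw [Real.norm_eq_abs]; exact hf ω)
  simpa [Real.norm_eq_abs] using h

/-- **E_cod — HAAR-CODED ⇒ CLUSTERING (PROVED; group-blind, `β`-blind).**  For every compact `G`, lattice representation
`r`, tail constant `K` and species `A, B` there is `C` such that whenever the torus Wilson measure at `β` is Haar-coded
at radius `b ≥ 1` with tail constant `K`, on every torus of side `2S+1 ≥ 4b` and for all `t ≤ S`,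
`|⟨A · τ_t B⟩_{β,S} − ⟨A⟩⟨B⟩| ≤ C e^{−t/(4b)}` — the skeleton's `FmtClustering r (HaarCoded r.ρ K) (1/4) 4`, δ-unfolded. -/
theorem codedClustering (r : LatticeRep G) (K : ℝ) (A B : YMSpecies G) :
    ∃ C : ℝ, ∀ (β : ℝ) (b : ℕ), 1 ≤ b → HaarCoded r.ρ K β b →
      ∀ S : ℕ, 4 * b ≤ 2 * S + 1 → ∀ t : ℕ, t ≤ S →
        |latticeConnectedCorr r.ρ β (2 * S + 1) A.F B.F t| ≤ C * Real.exp (-((1 / 4 : ℝ) * t / b)) := by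
  obtain ⟨CA, hCA⟩ := A.bounded
  obtain ⟨CB, hCB⟩ := B.bounded
  have hCA0 : 0 ≤ CA := le_trans (abs_nonneg _) (hCA fun _ => 1)
  have hCB0 : 0 ≤ CB := le_trans (abs_nonneg _) (hCB fun _ => 1)
  -- time extent of the supports and their sizes
  set D : ℕ := max (A.supp.sup fun z => (z.1 0).natAbs) (B.supp.sup fun z => (z.1 0).natAbs) with hD
  set nA : ℕ := A.supp.card with hnA
  set nB : ℕ := B.supp.card with hnB
  set Kp : ℝ := max K 0 with hKp
  refine ⟨2 * CA * CB * Real.exp (1 / 2 + (2 * D + 1) / 4) +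
    4 * CA * CB * (nA + nB) * Kp * Real.exp (1 + (2 * D + 1) / 2), ?_⟩
  intro β b hb hcoded S hS t htS
  set L : ℕ := 2 * S + 1 with hL
  obtain ⟨Φ, hΦm, hmap, hloc⟩ := hcoded S (by omega)
  set ν : Measure (GaugeConfig 4 (2 * S + 1) G) := Measure.pi fun _ => haarProbability G with hν
  haveI : IsProbabilityMeasure ν := by rw [hν]; infer_instance
  -- the two torus observables
  set a : GaugeConfig 4 (2 * S + 1) G → ℝ := fun U => A.F (torusLift (2 * S + 1) U) with ha
  set bt : GaugeConfig 4 (2 * S + 1) G → ℝ := fun U =>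
    B.F (configShift (-Pi.single 0 (t : ℤ)) (torusLift (2 * S + 1) U)) with hbt
  have ham : Measurable a := A.measurable.comp (measurable_torusLift _)
  have hbtm : Measurable bt := B.measurable.comp ((configShift _).measurable.comp (measurable_torusLift _))
  have hab : ∀ U, |a U| ≤ CA := fun U => hCA _
  have hbtb : ∀ U, |bt U| ≤ CB := fun U => hCB _
  -- push forward to the noise
  have hpush : ∀ {f : GaugeConfig 4 (2 * S + 1) G → ℝ}, Measurable f →
      ∫ U, f U ∂(wilsonMeasure (d := 4) (L := 2 * S + 1) r.ρ β) = ∫ ω, f (Φ ω) ∂ν := by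
    intro f hf
    rw [← hmap, integral_map hΦm.aemeasurable hf.aestronglyMeasurable]
  -- translation invariance of the Wilson measure: `⟨B⟩ = ⟨τ_t B⟩`
  have hbt_eq : ∫ U, B.F (torusLift (2 * S + 1) U) ∂(wilsonMeasure (d := 4) (L := 2 * S + 1) r.ρ β) =
      ∫ U, bt U ∂(wilsonMeasure (d := 4) (L := 2 * S + 1) r.ρ β) := by
    have hc := toTorusObservable_comp_configShift (G := G) (2 * S + 1) (-Pi.single (0 : Fin 4) (t : ℤ)) B.F
    have hbt' : bt = fun U => toTorusObservable (2 * S + 1) B.F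
        (torusConfigShift (Literature.Probability.LatticeModels.Torus.proj (2 * S + 1)
          (-Pi.single (0 : Fin 4) (t : ℤ))) U) := by
      funext U; exact congrFun hc U
    have h := wilsonExpectation_comp_torusConfigShift r.ρ β
      (Literature.Probability.LatticeModels.Torus.proj (2 * S + 1) (-Pi.single (0 : Fin 4) (t : ℤ)))
      (toTorusObservable (2 * S + 1) B.F)
    rw [hbt']
    simpa only [wilsonExpectation, Function.comp_apply, toTorusObservable_apply] using h.symm
  have hcov : latticeConnectedCorr r.ρ β (2 * S + 1) A.F B.F t =
      (∫ ω, a (Φ ω) * bt (Φ ω) ∂ν) - (∫ ω, a (Φ ω) ∂ν) * ∫ ω, bt (Φ ω) ∂ν := by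
    have h1 : ∫ U, A.F (torusLift (2 * S + 1) U) *
        B.F (configShift (-Pi.single 0 (t : ℤ)) (torusLift (2 * S + 1) U))
          ∂(wilsonMeasure (d := 4) (L := 2 * S + 1) r.ρ β) = ∫ ω, a (Φ ω) * bt (Φ ω) ∂ν :=
      hpush (f := fun U => a U * bt U) (ham.mul hbtm)
    have h2 : ∫ U, A.F (torusLift (2 * S + 1) U) ∂(wilsonMeasure (d := 4) (L := 2 * S + 1) r.ρ β) =
        ∫ ω, a (Φ ω) ∂ν := hpush (f := a) ham
    have h3 : ∫ U, bt U ∂(wilsonMeasure (d := 4) (L := 2 * S + 1) r.ρ β) = ∫ ω, bt (Φ ω) ∂ν :=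
      hpush (f := bt) hbtm
    unfold latticeConnectedCorr
    rw [hbt_eq, h1, h2, h3]
  -- a priori bounds
  have hIab : |∫ ω, a (Φ ω) * bt (Φ ω) ∂ν| ≤ CA * CB :=
    abs_integral_le_of_abs_le ν fun ω => by
      rw [abs_mul]; exact mul_le_mul (hab _) (hbtb _) (abs_nonneg _) hCA0
  have hIa : |∫ ω, a (Φ ω) ∂ν| ≤ CA := abs_integral_le_of_abs_le ν fun ω => hab _
  have hIb : |∫ ω, bt (Φ ω) ∂ν| ≤ CB := abs_integral_le_of_abs_le ν fun ω => hbtb _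
  have htriv : |latticeConnectedCorr r.ρ β (2 * S + 1) A.F B.F t| ≤ 2 * CA * CB := by
    rw [hcov]
    calc |(∫ ω, a (Φ ω) * bt (Φ ω) ∂ν) - (∫ ω, a (Φ ω) ∂ν) * ∫ ω, bt (Φ ω) ∂ν|
        ≤ |∫ ω, a (Φ ω) * bt (Φ ω) ∂ν| + |(∫ ω, a (Φ ω) ∂ν) * ∫ ω, bt (Φ ω) ∂ν| := abs_sub _ _
      _ ≤ CA * CB + CA * CB := by
          rw [abs_mul]; exact add_le_add hIab (mul_le_mul hIa hIb (abs_nonneg _) hCA0)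
      _ = 2 * CA * CB := by ring
  have hb1 : (1 : ℝ) ≤ b := by exact_mod_cast hb
  have hbpos : (0 : ℝ) < b := by linarith only [hb1]
  have hC2 : 0 ≤ 4 * CA * CB * (nA + nB) * Kp * Real.exp (1 + (2 * D + 1) / 2) := by
    have : 0 ≤ Kp := le_max_right _ _
    positivity
  have hC1 : 0 ≤ 2 * CA * CB * Real.exp (1 / 2 + (2 * D + 1) / 4) := by positivity
  by_cases hk : 1 ≤ (t - 2 * D - 1) / (2 * b)
  swap
  · -- small separation: the trivial bound suffices
    have ht_small : t < 2 * b + 2 * D + 1 := by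
      by_contra hcon
      push Not at hcon
      exact hk ((Nat.le_div_iff_mul_le (by omega)).2 (by omega))
    have hexp : Real.exp (-(1 / 2 + (2 * D + 1) / 4)) ≤ Real.exp (-((1 / 4 : ℝ) * t / b)) := by
      rw [Real.exp_le_exp, neg_le_neg_iff, div_le_iff₀ hbpos]
      have ht' : (t : ℝ) < 2 * b + 2 * D + 1 := by exact_mod_cast ht_small
      have hD0 : (0 : ℝ) ≤ D := Nat.cast_nonneg _
      have hprod : 0 ≤ (2 * (D : ℝ) + 1) * (b - 1) := mul_nonneg (by positivity) (by linarith only [hb1])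
      nlinarith only [ht', hD0, hprod, hb1]
    calc |latticeConnectedCorr r.ρ β (2 * S + 1) A.F B.F t| ≤ 2 * CA * CB := htriv
      _ = 2 * CA * CB * Real.exp (1 / 2 + (2 * D + 1) / 4) * Real.exp (-(1 / 2 + (2 * D + 1) / 4)) := by
          rw [mul_assoc (2 * CA * CB), ← Real.exp_add, add_neg_cancel, Real.exp_zero, mul_one]
      _ ≤ 2 * CA * CB * Real.exp (1 / 2 + (2 * D + 1) / 4) * Real.exp (-((1 / 4 : ℝ) * t / b)) :=
          mul_le_mul_of_nonneg_left hexp hC1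
      _ ≤ _ := by
          rw [add_mul]
          linarith only [mul_nonneg hC2 (Real.exp_pos (-((1 / 4 : ℝ) * t / b))).le]
  · -- coded regime
    set k : ℕ := (t - 2 * D - 1) / (2 * b) with hkdef
    have hkmul : k * (2 * b) ≤ t - 2 * D - 1 := Nat.div_mul_le_self _ _
    have h2b_le : 2 * b ≤ t - 2 * D - 1 := by
      have := (Nat.le_div_iff_mul_le (by omega)).1 hk; omega
    have hsep : 2 * (k * b + D) < t := by
      obtain ⟨m, hm⟩ : ∃ m, m = k * b := ⟨_, rfl⟩
      have hkm : k * (2 * b) = 2 * m := by rw [hm]; ring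
      rw [← hm]; rw [hkm] at hkmul; omega
    choose Ψ hΨm hΨdep hΨtail using fun z : Literature.MathematicalPhysics.QuantumLattice.ZdEdge 4 => hloc z k hk
    -- the coded replacements of `A` and of `τ_t B`
    set v : Literature.Probability.LatticeModels.Site 4 := -Pi.single (0 : Fin 4) (t : ℤ) with hv
    set FB : Finset (Literature.MathematicalPhysics.QuantumLattice.ZdEdge 4) := B.supp.image fun e => (e.1 - v, e.2) with hFB
    set OB : LGConfig 4 G → ℝ := B.F ∘ configShift v with hOB
    have hOA : DependsOn A.F (↑A.supp : Set (Literature.MathematicalPhysics.QuantumLattice.ZdEdge 4)) := A.isCylinder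
    have hOBdep : DependsOn OB (↑FB : Set (Literature.MathematicalPhysics.QuantumLattice.ZdEdge 4)) := IsCylinder.comp_configShift B.isCylinder v
    set A' : GaugeConfig 4 (2 * S + 1) G → ℝ := fun ω => A.F (fun z => Ψ z ω) with hA'
    set B' : GaugeConfig 4 (2 * S + 1) G → ℝ := fun ω => OB (fun z => Ψ z ω) with hB'
    set badA : Set (GaugeConfig 4 (2 * S + 1) G) :=
      ⋃ z ∈ A.supp, {ω | Φ ω (torusEdge (2 * S + 1) z) ≠ Ψ z ω} with hbadA
    set badB : Set (GaugeConfig 4 (2 * S + 1) G) :=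
      ⋃ z ∈ FB, {ω | Φ ω (torusEdge (2 * S + 1) z) ≠ Ψ z ω} with hbadB
    have hA'eq : ∀ ω, ω ∉ badA → a (Φ ω) = A' ω := fun ω hω => by
      refine obs_coded_eq Φ Ψ hOA fun z hz => ?_
      by_contra hne
      exact hω (Set.mem_biUnion (Finset.mem_coe.2 hz) hne)
    have hB'eq : ∀ ω, ω ∉ badB → bt (Φ ω) = B' ω := fun ω hω => by
      refine obs_coded_eq Φ Ψ hOBdep fun z hz => ?_
      by_contra hne
      exact hω (Set.mem_biUnion (Finset.mem_coe.2 hz) hne)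
    have hA'm : Measurable A' := measurable_obs_codes hΨm A.measurable
    have hB'm : Measurable B' := measurable_obs_codes hΨm (B.measurable.comp (configShift v).measurable)
    have hA'b : ∀ ω, |A' ω| ≤ CA := fun ω => hCA _
    have hB'b : ∀ ω, |B' ω| ≤ CB := fun ω => hCB _
    have hA'dep : DependsOn A' (⋃ z ∈ A.supp, inputBall (2 * S + 1) z (k * b)) :=
      dependsOn_obs_codes Ψ hOA _ fun z _ => hΨdep z
    have hB'dep : DependsOn B' (⋃ z ∈ FB, inputBall (2 * S + 1) z (k * b)) :=
      dependsOn_obs_codes Ψ hOBdep _ fun z _ => hΨdep z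
    -- masses of the bad events
    have hεA : (ν badA).toReal ≤ nA * (Kp * Real.exp (-(k : ℝ))) :=
      measure_bad_le Φ Ψ A.supp fun z _ => hΨtail z
    have hεB : (ν badB).toReal ≤ nB * (Kp * Real.exp (-(k : ℝ))) := by
      have h := measure_bad_le (ν := ν) Φ Ψ FB fun z _ => hΨtail z
      have hcard : (FB.card : ℝ) ≤ nB := by exact_mod_cast Finset.card_image_le
      have h0 : 0 ≤ Kp * Real.exp (-(k : ℝ)) := mul_nonneg (le_max_right _ _) (Real.exp_pos _).le
      exact h.trans (mul_le_mul_of_nonneg_right hcard h0)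
    -- disjoint input regions ⇒ the replacements are uncorrelated
    have hdisj : Disjoint (⋃ z ∈ A.supp, inputBall (2 * S + 1) z (k * b))
        (⋃ z ∈ FB, inputBall (2 * S + 1) z (k * b)) := by
      rw [Set.disjoint_left]
      intro q hqA hqB
      simp only [Set.mem_iUnion, inputBall, Set.mem_image, Set.mem_setOf_eq] at hqA hqB
      obtain ⟨z, hz, w, hw, hwq⟩ := hqA
      obtain ⟨z', hz', w', hw', hw'q⟩ := hqB
      rw [hFB, Finset.mem_image] at hz'
      obtain ⟨e, he, rfl⟩ := hz'
      have hzD : (z.1 0).natAbs ≤ D :=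
        le_trans (Finset.le_sup (f := fun z : Literature.MathematicalPhysics.QuantumLattice.ZdEdge 4 => (z.1 0).natAbs) hz) (le_max_left _ _)
      have heD : (e.1 0).natAbs ≤ D :=
        le_trans (Finset.le_sup (f := fun z : Literature.MathematicalPhysics.QuantumLattice.ZdEdge 4 => (z.1 0).natAbs) he) (le_max_right _ _)
      have heD' : ((e.1 - v) 0 - t).natAbs ≤ D := by
        simpa [hv] using heD
      have hne := torusEdge_ne_of_separated (S := S) hsep htS hzD heD' hw hw' w.2 w'.2
      exact hne (hwq.trans hw'q.symm)
    have hind : ∫ ω, A' ω * B' ω ∂ν = (∫ ω, A' ω ∂ν) * ∫ ω, B' ω ∂ν :=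
      integral_mul_eq_of_dependsOn_disjoint (haarProbability G) hA'm hB'm hA'dep hB'dep hdisj
    -- replacement estimates
    have hCAB0 : 0 ≤ CA * CB := mul_nonneg hCA0 hCB0
    have e1 : |(∫ ω, a (Φ ω) * bt (Φ ω) ∂ν) - ∫ ω, A' ω * B' ω ∂ν| ≤
        2 * (CA * CB) * (ν (badA ∪ badB)).toReal :=
      abs_integral_sub_le_of_eq_off ν (f := fun ω => a (Φ ω) * bt (Φ ω)) (f' := fun ω => A' ω * B' ω)
        ((ham.mul hbtm).comp hΦm) (hA'm.mul hB'm) hCAB0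
        (fun ω => by
          show |a (Φ ω) * bt (Φ ω)| ≤ CA * CB
          rw [abs_mul]; exact mul_le_mul (hab _) (hbtb _) (abs_nonneg _) hCA0)
        (fun ω => by
          show |A' ω * B' ω| ≤ CA * CB
          rw [abs_mul]; exact mul_le_mul (hA'b _) (hB'b _) (abs_nonneg _) hCA0)
        (badA ∪ badB) fun ω hω => by
          rw [Set.mem_union, not_or] at hω
          show a (Φ ω) * bt (Φ ω) = A' ω * B' ω
          rw [hA'eq ω hω.1, hB'eq ω hω.2]
    have e2 : |(∫ ω, a (Φ ω) ∂ν) - ∫ ω, A' ω ∂ν| ≤ 2 * CA * (ν badA).toReal :=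
      abs_integral_sub_le_of_eq_off ν (f := fun ω => a (Φ ω)) (f' := A') (ham.comp hΦm) hA'm hCA0
        (fun ω => hab _) hA'b badA hA'eq
    have e3 : |(∫ ω, bt (Φ ω) ∂ν) - ∫ ω, B' ω ∂ν| ≤ 2 * CB * (ν badB).toReal :=
      abs_integral_sub_le_of_eq_off ν (f := fun ω => bt (Φ ω)) (f' := B') (hbtm.comp hΦm) hB'm hCB0
        (fun ω => hbtb _) hB'b badB hB'eq
    have hJb : |∫ ω, B' ω ∂ν| ≤ CB := abs_integral_le_of_abs_le ν hB'b
    have hunion : (ν (badA ∪ badB)).toReal ≤ (ν badA).toReal + (ν badB).toReal := by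
      rw [← ENNReal.toReal_add (measure_ne_top ν _) (measure_ne_top ν _)]
      exact ENNReal.toReal_mono (ENNReal.add_ne_top.2 ⟨measure_ne_top ν _, measure_ne_top ν _⟩)
        (measure_union_le _ _)
    set εA := (ν badA).toReal with hεAdef
    set εB := (ν badB).toReal with hεBdef
    have hεA0 : 0 ≤ εA := ENNReal.toReal_nonneg
    have hεB0 : 0 ≤ εB := ENNReal.toReal_nonneg
    -- the four-epsilon bound
    have hmain : |latticeConnectedCorr r.ρ β (2 * S + 1) A.F B.F t| ≤ 4 * CA * CB * (εA + εB) := by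
      rw [hcov]
      set IAB := ∫ ω, a (Φ ω) * bt (Φ ω) ∂ν
      set IA := ∫ ω, a (Φ ω) ∂ν
      set IB := ∫ ω, bt (Φ ω) ∂ν
      set JA := ∫ ω, A' ω ∂ν
      set JB := ∫ ω, B' ω ∂ν
      have hsplit : IAB - IA * IB = (IAB - JA * JB) + ((JA - IA) * JB + IA * (JB - IB)) := by ring
      rw [hsplit]
      calc |IAB - JA * JB + ((JA - IA) * JB + IA * (JB - IB))|
          ≤ |IAB - JA * JB| + (|JA - IA| * |JB| + |IA| * |JB - IB|) := by
            refine le_trans (abs_add_le _ _) (add_le_add le_rfl ?_)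
            refine le_trans (abs_add_le _ _) ?_
            rw [abs_mul, abs_mul]
        _ ≤ 2 * (CA * CB) * (εA + εB) + (2 * CA * εA * CB + CA * (2 * CB * εB)) := by
            rw [← hind]
            refine add_le_add (e1.trans (mul_le_mul_of_nonneg_left hunion (by positivity))) ?_
            refine add_le_add ?_ ?_
            · rw [abs_sub_comm]; exact mul_le_mul e2 hJb (abs_nonneg _) (by positivity)
            · exact mul_le_mul hIa (by rw [abs_sub_comm]; exact e3) (abs_nonneg _) hCA0
        _ = 4 * CA * CB * (εA + εB) := by ring
    -- the exponential bookkeeping: `e^{-k} ≤ e^{1 + (2D+1)/2} e^{-t/(4b)}`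
    have hk_real : (t : ℝ) - 2 * D - 1 < 2 * b * (k + 1) := by
      have h := Nat.lt_div_mul_add (a := t - 2 * D - 1) (b := 2 * b) (by omega)
      have ht2 : 2 * D + 1 ≤ t := by omega
      have : ((t - 2 * D - 1 : ℕ) : ℝ) = (t : ℝ) - 2 * D - 1 := by
        rw [Nat.cast_sub (by omega), Nat.cast_sub (by omega)]; push_cast; ring
      rw [← this]
      have h' : ((t - 2 * D - 1 : ℕ) : ℝ) < ((t - 2 * D - 1) / (2 * b) * (2 * b) + 2 * b : ℕ) := by
        exact_mod_cast h
      rw [← hkdef] at h'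
      push_cast at h'
      linarith only [h']
    have hexp : Real.exp (-(k : ℝ)) ≤ Real.exp (1 + (2 * D + 1) / 2) * Real.exp (-((1 / 4 : ℝ) * t / b)) := by
      rw [← Real.exp_add, Real.exp_le_exp]
      have hD0 : (0 : ℝ) ≤ D := Nat.cast_nonneg _
      have ht0 : (0 : ℝ) ≤ t := Nat.cast_nonneg _
      -- from `t - 2D - 1 < 2b(k+1)`: `-k < 1 + (2D+1)/(2b) - t/(2b) ≤ 1 + (2D+1)/2 - t/(4b)`
      have h1 : -(k : ℝ) < 1 + (2 * D + 1) / (2 * b) - t / (2 * b) := by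
        have h2b : (0 : ℝ) < 2 * b := by positivity
        have hdiv : ((t : ℝ) - 2 * D - 1) / (2 * b) < k + 1 :=
          (div_lt_iff₀ h2b).2 (by linarith only [hk_real])
        have hsplit : ((t : ℝ) - 2 * D - 1) / (2 * b) = t / (2 * b) - (2 * D + 1) / (2 * b) := by
          field_simp
          ring
        linarith only [hdiv, hsplit]
      have h2 : (2 * (D : ℝ) + 1) / (2 * b) ≤ (2 * D + 1) / 2 :=
        div_le_div_of_nonneg_left (by positivity) (by norm_num) (by linarith)
      have h3 : (1 / 4 : ℝ) * t / b ≤ t / (2 * b) := by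
        rw [show (1 / 4 : ℝ) * t / b = t / (4 * b) by ring]
        exact div_le_div_of_nonneg_left ht0 (by positivity) (by linarith only [hbpos])
      linarith only [h1, h2, h3]
    calc |latticeConnectedCorr r.ρ β (2 * S + 1) A.F B.F t| ≤ 4 * CA * CB * (εA + εB) := hmain
      _ ≤ 4 * CA * CB * ((nA + nB) * (Kp * Real.exp (-(k : ℝ)))) := by
          refine mul_le_mul_of_nonneg_left ?_ (by positivity)
          linarith only [add_le_add hεA hεB]
      _ = 4 * CA * CB * (nA + nB) * Kp * Real.exp (-(k : ℝ)) := by ring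
      _ ≤ 4 * CA * CB * (nA + nB) * Kp * (Real.exp (1 + (2 * D + 1) / 2) *
            Real.exp (-((1 / 4 : ℝ) * t / b))) := by
          refine mul_le_mul_of_nonneg_left hexp ?_
          have : 0 ≤ Kp := le_max_right _ _
          positivity
      _ = 4 * CA * CB * (nA + nB) * Kp * Real.exp (1 + (2 * D + 1) / 2) *
            Real.exp (-((1 / 4 : ℝ) * t / b)) := by ring
      _ ≤ _ := by
          rw [add_mul]
          linarith only [mul_nonneg hC1 (Real.exp_pos (-((1 / 4 : ℝ) * t / b))).le]

end Engine

end Summit.QuantumFields.YangMills.Cruxes.IR.HaarCodingEngine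

end
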